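import Summits.RiemannHypothesis.RiemannHypothesis.Theorems.Splittings.LiIndexSetsPrelims
import HarnessLib

/-!
# Splittings — Li neg lens: the ζ-LIKE QUADRUPLE OF FAKE ZEROS tuned to a geometric progression (witness vocabulary for
# `LiSlowRecurrenceHeightRescue`; SPLIT-li-neg gen 3, def-carrying part)

Cell rh-split, seat rh-split-li-neg g3 (brief sha16 f79c5f09d8bcb036), card `run/shared/lean/pub/rh-split/cards/SPLIT-li-neg.md`
§9 (gen-3 addendum; referee rh-split-ref g2 2026-08-27T01:27:02Z: DELIVERABLE, farm rc 0 / 0 warn / 0 sorry, std axioms on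
`not_multisetLiCriterionOnAbove_geom` / `riemannHypothesis_iff_liPosOn_of_bohrShift_le_200`, «CONTENT PASS in advance for a
zero-def (or def-spelled) carve of e8ec9abfbb5d6735»); source `HOME/rh-split-li-neg/LiSlowRecurrence.lean` sha16 e8ec9abfbb5d6735,
whose §§1–5 are the LANDED `Theorems/Splittings/LiSlowRecurrence.lean` (p489464, typer-1 g3; `IsSlowRecurrent` / `IsBohrRecurrentShift`
spelled out there).  Filed by rh-split-typer-1 g4.
This part carries the scratch's §8/§8b witness VOCABULARY as definitions (review-queued; no `Prop` is defined here):
`Quadruple.wOf r σ = r e^{iσ}`, the fake zero `Quadruple.rhoOf r σ = (1 − w)⁻¹` (so `1 − 1/ρ = w`), the `Bool × Bool`-indexed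
radii/angles `rad`, `ang` and the quadruple `quad λ θ` of fake zeros `(1 − λ^{±1}e^{±iθ})⁻¹` — closed under `w ↦ w̄` and
`w ↦ 1/w̄`, i.e. `ρ, ρ̄, 1 − ρ̄, 1 − ρ` as for ζ —, with its Li sums `Σ_b Re(1 − w_bⁿ) = 4 − 2cos(nθ)(λⁿ + λ⁻ⁿ)` (`quad_liSum`)
and the height bound `|Im ρ| ≥ 1/(2θ)` (`half_inv_le_abs_im_rhoOf`); and the `(q+1)`-adic tail angle `Geom.phi q = 2π a_q/(q+1)`,
`a_q = ⌊(q+1)/2⌋`, with `cos(q^j φ_q) = cos φ_q < 0` for every `j` (`q ≡ −1 (mod q+1)`).  Namespace delta: the scratch's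
sub-namespace `PowTwo` is called `Quadruple` here (its `{2^k}` theorem is filed as the `q = 2` instance of the geometric one).
HONEST LABEL: «SPLITTING SEARCH over kernel-typed RH-EQUIVALENCES; a splitting A ∧ B ⟹ RH is CONDITIONAL bookkeeping
unless A and B are both proved; nothing here bears on the truth of RH.»
-/

set_option linter.dupNamespace false

noncomputable section

open Complex Filter Topology Set
open scoped ComplexConjugate Real

namespace Summit.RiemannHypothesis.RiemannHypothesis.Theorems.Splittings.LiSlowRecurrence

open Literature.NumberTheory.LFunctions
open Summit.RiemannHypothesis.RiemannHypothesis.Theorems.Splittings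
open Summit.RiemannHypothesis.RiemannHypothesis.Theorems.Splittings.LiIndexSets

/-! ## The quadruple of fake zeros `(1 − λ^{±1} e^{±iθ})⁻¹` -/

namespace Quadruple

/-- `w = r e^{iσ}`. -/
def wOf (r σ : ℝ) : ℂ := (r : ℂ) * exp ((σ : ℂ) * I)

/-- The fake zero `ρ = (1 − w)⁻¹` (so that `1 − 1/ρ = w`). -/
def rhoOf (r σ : ℝ) : ℂ := (1 - wOf r σ)⁻¹

/-- `|w| = r` for `w = r e^{iσ}`, `r ≥ 0`. -/
theorem norm_wOf {r : ℝ} (hr : 0 ≤ r) (σ : ℝ) : ‖wOf r σ‖ = r := by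
  rw [wOf, norm_mul, Complex.norm_real, Real.norm_of_nonneg hr, Complex.norm_exp_ofReal_mul_I, mul_one]

/-- `Im w = r sin σ`. -/
theorem wOf_im (r σ : ℝ) : (wOf r σ).im = r * Real.sin σ := by
  rw [wOf, Complex.im_ofReal_mul, Complex.exp_ofReal_mul_I_im]

/-- `Re wⁿ = rⁿ cos(nσ)`. -/
theorem re_wOf_pow (r σ : ℝ) (n : ℕ) : ((wOf r σ) ^ n).re = r ^ n * Real.cos (n * σ) := by
  rw [wOf, mul_pow, ← Complex.ofReal_pow, ← Complex.exp_nat_mul, Complex.re_ofReal_mul]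
  congr 1
  have : (n : ℂ) * ((σ : ℂ) * I) = ((n * σ : ℝ) : ℂ) * I := by push_cast; ring
  rw [this, Complex.exp_ofReal_mul_I_re]

/-- `|1 − w| ≤ |σ| + |r − 1|`. -/
theorem norm_one_sub_wOf_le (r σ : ℝ) : ‖1 - wOf r σ‖ ≤ |σ| + |r - 1| := by
  have e : 1 - wOf r σ = -(exp ((σ : ℂ) * I) - 1) - ((r : ℂ) - 1) * exp ((σ : ℂ) * I) := by
    rw [wOf]; ring
  have hexp : ‖exp ((σ : ℂ) * I) - 1‖ ≤ |σ| := by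
    have h := Real.norm_exp_I_mul_ofReal_sub_one_le (x := σ)
    rw [mul_comm] at h
    simpa [Real.norm_eq_abs] using h
  rw [e]
  calc ‖-(exp ((σ : ℂ) * I) - 1) - ((r : ℂ) - 1) * exp ((σ : ℂ) * I)‖
      ≤ ‖-(exp ((σ : ℂ) * I) - 1)‖ + ‖((r : ℂ) - 1) * exp ((σ : ℂ) * I)‖ := norm_sub_le _ _
    _ = ‖exp ((σ : ℂ) * I) - 1‖ + |r - 1| := by
        rw [norm_neg, norm_mul, Complex.norm_exp_ofReal_mul_I, mul_one, ← Complex.ofReal_one,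
          ← Complex.ofReal_sub, Complex.norm_real, Real.norm_eq_abs]
    _ ≤ |σ| + |r - 1| := by gcongr

/-- `1 − 1/ρ = w` for the fake zero `ρ = (1 − w)⁻¹`. -/
theorem one_sub_one_div_rhoOf (r σ : ℝ) : 1 - 1 / rhoOf r σ = wOf r σ := by
  simp [rhoOf]

/-- `ρ ≠ 0` (`r ≥ 0`, `r ≠ 1`). -/
theorem rhoOf_ne_zero {r : ℝ} (hr : 0 ≤ r) (hr1 : r ≠ 1) (σ : ℝ) : rhoOf r σ ≠ 0 := by
  rw [rhoOf]
  refine inv_ne_zero fun h ↦ hr1 ?_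
  have hw : wOf r σ = 1 := by linear_combination -h
  have := congrArg (fun z : ℂ ↦ ‖z‖) hw
  simpa [norm_wOf hr] using this

/-- `ρ ≠ 1` (`r ≠ 0`). -/
theorem rhoOf_ne_one {r : ℝ} (hr : r ≠ 0) (σ : ℝ) : rhoOf r σ ≠ 1 := by
  rw [rhoOf]
  intro h
  have hw : wOf r σ = 0 := by
    have : 1 - wOf r σ = 1 := inv_eq_one.1 h
    linear_combination -this
  rw [wOf, mul_eq_zero] at hw
  rcases hw with h | h
  · exact hr (by exact_mod_cast h)
  · exact Complex.exp_ne_zero _ h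

/-- `Re ρ < 1/2` when `|w| = r > 1` (tree `re_inv_one_sub_lt_half`). -/
theorem re_rhoOf_lt_half {r : ℝ} (hr : 1 < r) (σ : ℝ) : (rhoOf r σ).re < 1 / 2 :=
  re_inv_one_sub_lt_half (by rw [norm_wOf (by linarith)]; exact hr)

/-- `|Im ρ| = r|sin σ|/|1 − w|²`. -/
theorem abs_im_rhoOf {r : ℝ} (hr : 0 < r) (σ : ℝ) :
    |(rhoOf r σ).im| = r * |Real.sin σ| / Complex.normSq (1 - wOf r σ) := by
  rw [rhoOf, Complex.inv_im, sub_im, one_im, wOf_im, zero_sub, neg_neg, abs_div, abs_mul,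
    abs_of_pos hr, abs_of_nonneg (Complex.normSq_nonneg _)]

/-- **Height of the fake zeros**: radius within `2θ³` of `1`, angle `±θ`, `0 < θ ≤ 27/100` ⟹
`|Im ρ| ≥ 1/(2θ)`. -/
theorem half_inv_le_abs_im_rhoOf {θ r σ : ℝ} (hθ0 : 0 < θ) (hθ1 : θ ≤ 27 / 100)
    (hσ : σ = θ ∨ σ = -θ) (hr0 : 0 < r) (hr : |r - 1| ≤ 2 * θ ^ 3) :
    1 / (2 * θ) ≤ |(rhoOf r σ).im| := by
  have hs : 0 < Real.sin θ := Real.sin_pos_of_pos_of_lt_pi hθ0 (by linarith [Real.pi_gt_three])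
  have hsinσ : |Real.sin σ| = Real.sin θ := by
    rcases hσ with rfl | rfl
    · exact abs_of_pos hs
    · rw [Real.sin_neg, abs_neg, abs_of_pos hs]
  have hσabs : |σ| = θ := by
    rcases hσ with rfl | rfl
    · exact abs_of_pos hθ0
    · rw [abs_neg, abs_of_pos hθ0]
  rw [abs_im_rhoOf hr0, hsinσ]
  have hD : ‖1 - wOf r σ‖ ≤ θ + 2 * θ ^ 3 := by
    calc ‖1 - wOf r σ‖ ≤ |σ| + |r - 1| := norm_one_sub_wOf_le r σ
      _ ≤ θ + 2 * θ ^ 3 := by rw [hσabs]; linarith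
  have hnormSq_pos : 0 < Complex.normSq (1 - wOf r σ) := by
    rw [Complex.normSq_pos]
    intro h
    have him := congrArg Complex.im h
    rw [sub_im, one_im, wOf_im, zero_im] at him
    have h2 : r * Real.sin σ = 0 := by linarith
    rcases mul_eq_zero.1 h2 with h3 | h3
    · exact hr0.ne' h3
    · have : |Real.sin σ| = 0 := by rw [h3, abs_zero]
      rw [hsinσ] at this
      exact hs.ne' this
  rw [div_le_div_iff₀ (by positivity) hnormSq_pos, one_mul]
  have hsin : θ - θ ^ 3 / 6 ≤ Real.sin θ := Real.sin_ge_sub_cube hθ0.le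
  have hr_lb : 1 - 2 * θ ^ 3 ≤ r := by have := (abs_le.1 hr).1; linarith
  have ht2 : θ ^ 2 ≤ 729 / 10000 := by nlinarith
  have ht3 : θ ^ 3 ≤ 2 / 100 := by nlinarith
  have hpoly : (1 + 2 * θ ^ 2) ^ 2 ≤ 2 * ((1 - 2 * θ ^ 3) * (1 - θ ^ 2 / 6)) := by nlinarith
  have h13 : 0 ≤ 1 - 2 * θ ^ 3 := by linarith
  have h16 : 0 ≤ θ - θ ^ 3 / 6 := by nlinarith
  calc Complex.normSq (1 - wOf r σ) = ‖1 - wOf r σ‖ ^ 2 := (Complex.sq_norm _).symm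
    _ ≤ (θ + 2 * θ ^ 3) ^ 2 := by gcongr
    _ = θ ^ 2 * (1 + 2 * θ ^ 2) ^ 2 := by ring
    _ ≤ θ ^ 2 * (2 * ((1 - 2 * θ ^ 3) * (1 - θ ^ 2 / 6))) := by gcongr
    _ = (1 - 2 * θ ^ 3) * (θ - θ ^ 3 / 6) * (2 * θ) := by ring
    _ ≤ r * Real.sin θ * (2 * θ) := by gcongr

/-- `cos(2^{j+1} π/3) = −1/2` (`2^j ≡ 1, 2 (mod 3)`). -/
theorem cos_two_pow_succ_mul_pi_div_three (j : ℕ) : Real.cos (2 ^ (j + 1) * π / 3) = -1 / 2 := by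
  have h3 : ¬ 3 ∣ 2 ^ j := fun h ↦ by
    have := Nat.Prime.dvd_of_dvd_pow Nat.prime_three h
    omega
  have hr0 : 2 ^ j % 3 ≠ 0 := fun h0 ↦ h3 (Nat.dvd_of_mod_eq_zero h0)
  have hr3 : 2 ^ j % 3 < 3 := Nat.mod_lt _ (by norm_num)
  have hqr : 2 ^ j = 3 * (2 ^ j / 3) + 2 ^ j % 3 := (Nat.div_add_mod _ _).symm
  set q := 2 ^ j / 3 with hq
  set r := 2 ^ j % 3 with hr
  have e : (2 : ℝ) ^ (j + 1) * π / 3 = 2 * r * π / 3 + q * (2 * π) := by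
    have hc : ((2 : ℝ) ^ j) = 3 * q + r := by exact_mod_cast hqr
    rw [pow_succ, hc]; ring
  rw [e, Real.cos_add_nat_mul_two_pi]
  have hr12 : r = 1 ∨ r = 2 := by omega
  rcases hr12 with h | h
  · rw [h]
    have : (2 : ℝ) * ((1 : ℕ) : ℝ) * π / 3 = π - π / 3 := by push_cast; ring
    rw [this, Real.cos_pi_sub, Real.cos_pi_div_three]; norm_num
  · rw [h]
    have : (2 : ℝ) * ((2 : ℕ) : ℝ) * π / 3 = π / 3 + π := by push_cast; ring
    rw [this, Real.cos_add_pi, Real.cos_pi_div_three]; norm_num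

/-- Radius and angle of the four members, indexed by `Bool × Bool`. -/
def rad (l : ℝ) (b : Bool × Bool) : ℝ := bif b.1 then l else l⁻¹
/-- see `rad` -/
def ang (θ : ℝ) (b : Bool × Bool) : ℝ := bif b.2 then θ else -θ

/-- The quadruple of fake zeros. -/
def quad (l θ : ℝ) (b : Bool × Bool) : ℂ := rhoOf (rad l b) (ang θ b)

/-- `cos(n·(±θ)) = cos(nθ)`. -/
theorem cos_mul_ang (θ : ℝ) (b : Bool × Bool) (n : ℕ) : Real.cos (n * ang θ b) = Real.cos (n * θ) := by
  unfold ang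
  cases b.2
  · simp [mul_neg, Real.cos_neg]
  · simp

/-- **The Li sums of the quadruple**: `Σ_b Re(1 − w_bⁿ) = 4 − 2 cos(nθ) (λⁿ + λ⁻ⁿ)`. -/
theorem quad_liSum (l θ : ℝ) (n : ℕ) :
    ∑ b : Bool × Bool, (1 - (1 - 1 / quad l θ b) ^ n).re
      = 4 - 2 * Real.cos (n * θ) * (l ^ n + l⁻¹ ^ n) := by
  simp only [quad, one_sub_one_div_rhoOf, sub_re, one_re, re_wOf_pow, cos_mul_ang]
  simp only [Fintype.sum_prod_type, Fintype.sum_bool, rad, cond_true, cond_false]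
  ring

end Quadruple

/-! ## The `(q+1)`-adic tail angle of a geometric progression `{q^k}`, `q ≥ 2`

Angle unit `φ_q = 2π a/(q+1)` with `a = ⌊(q+1)/2⌋`: since `q ≡ −1 (mod q+1)`, `q^j a ≡ (−1)^j a`, so
`cos(q^j φ_q) = cos φ_q < 0` for every `j` (for `q = 2`: `φ = 2π/3`, `cos = −1/2`). -/

namespace Geom

/-- `a_q = ⌊(q+1)/2⌋`. -/
def half (q : ℕ) : ℕ := (q + 1) / 2

/-- The tail angle `φ_q = 2π a_q/(q+1)`. -/
def phi (q : ℕ) : ℝ := 2 * π * (half q : ℝ) / ((q : ℝ) + 1)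

/-- `q^j · a_q ≡ (−1)^j a_q (mod q+1)` (since `q ≡ −1`). -/
theorem pow_mul_half_modEq (q j : ℕ) :
    ∃ m : ℤ, ((q : ℤ) ^ j) * (half q : ℤ) = m * ((q : ℤ) + 1) + (-1) ^ j * (half q : ℤ) := by
  induction j with
  | zero => exact ⟨0, by simp⟩
  | succ j ih =>
    obtain ⟨m, hm⟩ := ih
    refine ⟨(q : ℤ) * m + (-1) ^ j * (half q : ℤ), ?_⟩
    rw [pow_succ, mul_comm ((q : ℤ) ^ j) (q : ℤ), mul_assoc, hm]
    ring

/-- `cos(q^j φ_q) = cos φ_q` for every `j`. -/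
theorem cos_pow_mul_phi (q j : ℕ) : Real.cos ((q : ℝ) ^ j * phi q) = Real.cos (phi q) := by
  obtain ⟨m, hm⟩ := pow_mul_half_modEq q j
  have hq1 : ((q : ℝ) + 1) ≠ 0 := by positivity
  have hm' : ((q : ℝ) ^ j) * (half q : ℝ) = (m : ℝ) * ((q : ℝ) + 1) + (-1) ^ j * (half q : ℝ) := by
    exact_mod_cast hm
  have hc : phi q = (2 * π / ((q : ℝ) + 1)) * (half q : ℝ) := by unfold phi; ring
  have e : (q : ℝ) ^ j * phi q = (-1) ^ j * phi q + (m : ℝ) * (2 * π) := by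
    calc (q : ℝ) ^ j * phi q = (2 * π / ((q : ℝ) + 1)) * (((q : ℝ) ^ j) * (half q : ℝ)) := by
          rw [hc]; ring
      _ = (2 * π / ((q : ℝ) + 1)) * ((m : ℝ) * ((q : ℝ) + 1) + (-1) ^ j * (half q : ℝ)) := by rw [hm']
      _ = (-1) ^ j * ((2 * π / ((q : ℝ) + 1)) * (half q : ℝ)) + (m : ℝ) * (2 * π) := by
          field_simp
          ring
      _ = (-1) ^ j * phi q + (m : ℝ) * (2 * π) := by rw [← hc]
  rw [e, Real.cos_add_int_mul_two_pi]
  rcases Nat.even_or_odd j with hj | hj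
  · rw [hj.neg_one_pow, one_mul]
  · rw [hj.neg_one_pow, neg_one_mul, Real.cos_neg]

/-- `φ_q ≤ π`. -/
theorem phi_le_pi (q : ℕ) : phi q ≤ π := by
  unfold phi half
  have h2 : (2 : ℝ) * (((q + 1) / 2 : ℕ) : ℝ) ≤ (q : ℝ) + 1 := by
    have : 2 * ((q + 1) / 2) ≤ q + 1 := Nat.mul_div_le (q + 1) 2
    exact_mod_cast this
  rw [div_le_iff₀ (by positivity)]
  nlinarith [Real.pi_pos]

/-- `π/2 < φ_q` for `q ≥ 2`. -/
theorem pi_div_two_lt_phi {q : ℕ} (hq : 2 ≤ q) : π / 2 < phi q := by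
  unfold phi half
  have h4 : (q : ℝ) + 1 < 4 * (((q + 1) / 2 : ℕ) : ℝ) := by
    have : q + 1 < 4 * ((q + 1) / 2) := by omega
    exact_mod_cast this
  rw [lt_div_iff₀ (by positivity)]
  nlinarith [Real.pi_pos]

/-- `cos φ_q < 0` for `q ≥ 2`. -/
theorem cos_phi_neg {q : ℕ} (hq : 2 ≤ q) : Real.cos (phi q) < 0 :=
  Real.cos_neg_of_pi_div_two_lt_of_lt (pi_div_two_lt_phi hq) (by linarith [phi_le_pi q, Real.pi_pos])

end Geom

end Summit.RiemannHypothesis.RiemannHypothesis.Theorems.Splittings.LiSlowRecurrence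

end
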